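import Summits.Ventures.PercRepro.RankLevelSetDepCountGiantA2
import Summits.Ventures.PercRepro.RankLevelSetCorankFiveCounts

/-!
# PercRepro — THE GIANT FLAT IS UNIQUE: THE `U`-COUNT WITH THE BIG CLASS SPLIT AT IT (p8, S3; part B)

`proofs/SUBCLAIM-S3-p8.md` §3d. Nullity is supermodular (`eRk_inter_add_eRk_union_le` + `|A ∪ B| + |A ∩ B| = |A| + |B|`)
and bounded by `d` on every subset (`encard_le_eRk_add_of_encard_eq`). Two DISTINCT rank-`q` flats meet in a flat of
rank `≤ q − 1`, whose nullity is `≤ ν_∩` (`hinter`: on the core at `q = 6`, `ν_∩ = 16 = max_{r ≤ 5} (f(r) − r)`). So if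
both have nullity `≥ ν₁` with `2ν₁ > d + ν_∩`, then `2ν₁ − ν_∩ ≤ ν(F₁) + ν(F₂) − ν(F₁ ∩ F₂) ≤ ν(F₁ ∪ F₂) ≤ d` —
contradiction: **at most one rank-`q` flat has `≥ q + ν₁` points** (`closure_eq_of_giant`). Hence the big class of the
split count (closures with `> f′ + 1` points) splits into the MID pairs (closure `< q + ν₁` points, fibre over `≤ ν₁ − 2`
free points) and the GIANT pairs — all inside the one giant flat `F*`, at most `Σ_k s_k·C(|F*|, q + 1 − k)` of them with
`|F*| ≤ min(f, q + d)` (`card_pairsGiant_le`). With the per-size double count and the multiplicity weights of part A: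

  `#{B ⊆ E : r(B) = q, |B| ≤ d} ≤ C(n, q) + σ(f′ − q)·P_E + σ(min(f − q − 1, ν₁ − 2))·P_{S₀} + σ(F_max − q − 1)·P_{F*}`,
  `σ(m) = Σ_{j ≤ d−q−1} C(m, j)/(j + 1)`, `P_S = Σ_k s_k·C(|S|, q + 1 − k)` with `|E| = n`, `|S₀| ≤ (q+1)d`,
  `|F*| ≤ F_max := min(f, q + d)`  (`ncard_eRk_eq_ncard_le_le_giant`, in `ℚ`).

At `q = 6` on the core this moves the counting frontier of the window from `255` to `175` (the binding corank becomes
`16`, the SMALL class — i.e. `f(5)` is the lever from there). Axioms: standard.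
-/

open scoped Matroid

namespace PercRepro

namespace Matroid

open Set Finset

variable {α : Type} {M : _root_.Matroid α}

/-- The rank of a finite set is a natural number. -/
theorem exists_eRk_eq_nat [M.Finite] {X : Set α} (hX : X ⊆ M.E) : ∃ k : ℕ, M.eRk X = (k : ℕ∞) := by
  have hfin : X.Finite := M.ground_finite.subset hX
  have h : M.eRk X ≠ ⊤ := by
    have := M.eRk_le_encard X
    exact ne_top_of_le_ne_top hfin.encard_lt_top.ne this
  exact ENat.ne_top_iff_exists.1 h |>.imp (fun k hk => hk.symm)

open scoped Classical in
/-- The GIANT pairs: big pairs whose closure has at least `q + ν₁` points. -/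
noncomputable def pairsGiant (M : _root_.Matroid α) [M.Finite] (q f' ν₁ : ℕ) : Finset (Set α × Set α) :=
  (pairsBig M q f').filter (fun p => q + ν₁ ≤ (M.closure (p.1 ∪ p.2)).ncard)

open scoped Classical in
/-- The MID pairs: big pairs whose closure has fewer than `q + ν₁` points. -/
noncomputable def pairsMid (M : _root_.Matroid α) [M.Finite] (q f' ν₁ : ℕ) : Finset (Set α × Set α) :=
  (pairsBig M q f').filter (fun p => ¬ q + ν₁ ≤ (M.closure (p.1 ∪ p.2)).ncard)

open scoped Classical in
/-- A big pair spans a rank-`q` flat (a closure with `> f′ + 1` points cannot have rank `≤ q − 1`). -/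
theorem eRk_closure_eq_of_big [M.Finite] {q f' : ℕ} (hq : 1 ≤ q)
    (hflat' : ∀ X ⊆ M.E, M.eRk X ≤ (q - 1 : ℕ) → X.ncard ≤ f') {p : Set α × Set α}
    (hp : p ∈ pairsBig M q f') : M.eRk (M.closure (p.1 ∪ p.2)) = (q : ℕ∞) := by
  unfold pairsBig at hp
  rw [Finset.mem_filter] at hp
  obtain ⟨hpP, hbig⟩ := hp
  push Not at hbig
  obtain ⟨hp1E, hp2E, -, hrk, -⟩ := pairsF_data hpP
  have hUE : p.1 ∪ p.2 ⊆ M.E := union_subset hp1E hp2E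
  rw [M.eRk_closure_eq]
  obtain ⟨k, hk⟩ := exists_eRk_eq_nat (M := M) hUE
  rw [hk] at hrk ⊢
  have hkq : k ≤ q := by exact_mod_cast hrk
  rcases hkq.lt_or_eq with hlt | heq
  · exfalso
    have := hflat' (M.closure (p.1 ∪ p.2)) (M.closure_subset_ground _)
      (by rw [M.eRk_closure_eq, hk]; exact_mod_cast (by omega : k ≤ q - 1))
    omega
  · rw [heq]

open scoped Classical in
/-- **The giant flat is unique**: two giant pairs have the same closure. -/
theorem closure_eq_of_giant [M.Finite] {q f' ν₁ νi : ℕ} (hq : 1 ≤ q)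
    (hflat' : ∀ X ⊆ M.E, M.eRk X ≤ (q - 1 : ℕ) → X.ncard ≤ f')
    (hinter : ∀ X ⊆ M.E, M.eRk X ≤ (q - 1 : ℕ) → (X.ncard : ℕ∞) ≤ M.eRk X + νi)
    {d : ℕ} (hd : M.E.encard = M.eRank + d) (h2 : d + νi < 2 * ν₁)
    {p₁ p₂ : Set α × Set α} (h₁ : p₁ ∈ pairsGiant M q f' ν₁) (h₂ : p₂ ∈ pairsGiant M q f' ν₁) :
    M.closure (p₁.1 ∪ p₁.2) = M.closure (p₂.1 ∪ p₂.2) := by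
  unfold pairsGiant at h₁ h₂
  rw [Finset.mem_filter] at h₁ h₂
  obtain ⟨h₁b, h₁g⟩ := h₁
  obtain ⟨h₂b, h₂g⟩ := h₂
  set F₁ := M.closure (p₁.1 ∪ p₁.2) with hF₁
  set F₂ := M.closure (p₂.1 ∪ p₂.2) with hF₂
  have hF₁E : F₁ ⊆ M.E := M.closure_subset_ground _
  have hF₂E : F₂ ⊆ M.E := M.closure_subset_ground _
  have hF₁fin : F₁.Finite := M.ground_finite.subset hF₁E
  have hF₂fin : F₂.Finite := M.ground_finite.subset hF₂E
  have hr₁ : M.eRk F₁ = (q : ℕ∞) := eRk_closure_eq_of_big hq hflat' h₁b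
  have hr₂ : M.eRk F₂ = (q : ℕ∞) := eRk_closure_eq_of_big hq hflat' h₂b
  by_contra hne
  -- the intersection has rank `≤ q − 1`
  have hinterE : F₁ ∩ F₂ ⊆ M.E := inter_subset_left.trans hF₁E
  obtain ⟨a, ha⟩ := exists_eRk_eq_nat (M := M) hinterE
  have haq : a ≤ q := by
    have := M.eRk_mono (inter_subset_left : F₁ ∩ F₂ ⊆ F₁)
    rw [ha, hr₁] at this
    exact_mod_cast this
  have halt : a ≤ q - 1 := by
    by_contra hcon
    have haeq : a = q := by omega
    -- then `cl(F₁ ∩ F₂) = F₁ = F₂`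
    have hc₁ : M.closure (F₁ ∩ F₂) = M.closure F₁ :=
      (M.isRkFinite_of_finite (hF₁fin.subset inter_subset_left)).closure_eq_closure_of_subset_of_eRk_ge_eRk
        inter_subset_left (by rw [ha, hr₁, haeq])
    have hc₂ : M.closure (F₁ ∩ F₂) = M.closure F₂ :=
      (M.isRkFinite_of_finite (hF₂fin.subset inter_subset_right)).closure_eq_closure_of_subset_of_eRk_ge_eRk
        inter_subset_right (by rw [ha, hr₂, haeq])
    apply hne
    rw [hF₁, hF₂, ← M.closure_closure (p₁.1 ∪ p₁.2), ← M.closure_closure (p₂.1 ∪ p₂.2)]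
    rw [← hF₁, ← hF₂, ← hc₁, hc₂]
  -- the nullity bookkeeping, in `ℕ`
  obtain ⟨b, hb⟩ := exists_eRk_eq_nat (M := M) (union_subset hF₁E hF₂E)
  have hsub := M.eRk_inter_add_eRk_union_le F₁ F₂
  rw [ha, hb, hr₁, hr₂] at hsub
  have hsub' : a + b ≤ q + q := by exact_mod_cast hsub
  have hcap := encard_le_eRk_add_of_encard_eq (M := M) (union_subset hF₁E hF₂E) hd
  rw [hb, ← (hF₁fin.union hF₂fin).cast_ncard_eq] at hcap
  have hcap' : (F₁ ∪ F₂).ncard ≤ b + d := by exact_mod_cast hcap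
  have hint := hinter (F₁ ∩ F₂) hinterE (by rw [ha]; exact_mod_cast halt)
  rw [ha] at hint
  have hint' : (F₁ ∩ F₂).ncard ≤ a + νi := by exact_mod_cast hint
  have hsum := Set.ncard_union_add_ncard_inter F₁ F₂ hF₁fin hF₂fin
  omega

end Matroid

end PercRepro
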